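import Summits.Ventures.CertifiedArithmetic.LowPrec.Directed

/-!
# Structural envelopes of the directed roundings (Theorem E2, every format)

HONEST FRAMING (venture CertifiedArithmetic / cell `pub-lowprec`): certified error envelopes and
provably optimal rounding/accumulation schemes for low-precision formats under stated cost models;
every table by two implementations; no hardware or vendor claims.

For `|x| ≤ maxRat` and `s` the spacing exponent of the binade of `|x|` (`Format.shift`), the
directed roundings of `Directed.lean` satisfy the STRICT one-ulp envelopes
`x - ↓x < 2^s·quantum`, `↑x - x < 2^s·quantum`, `|x - RZ x| < 2^s·quantum`
(`sub_roundDown_lt`, `roundUp_sub_lt`, `abs_sub_roundTowardZero_lt`), and in the normal range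
`2^m·quantum ≤ |x|` the relative forms `|x - RZ x| < 2u·|x|` and the sharper
`|x - RZ x| ≤ 2u/(1+2u)·|x|` (`abs_sub_roundTowardZero_le_sharp`) — the directed-mode rows of the
cell's THEOREMS-R1 §3 (E2). All formats, no enumeration.
-/

namespace Literature.ComputerArithmetic.FloatingPoint

namespace Format

variable {φ : Format}

/-- In range the round-down is the floor multiple (no clamping). [folklore] -/
theorem rdGrid_eq_floor_mul {r : ℚ} (hr : 0 ≤ r) (hle : r ≤ φ.maxScaled) :
    φ.rdGrid r = (⌊r / (2 : ℚ) ^ φ.shift ⌊r⌋.toNat⌋).toNat * 2 ^ φ.shift ⌊r⌋.toNat := by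
  unfold rdGrid
  set t : ℕ := (⌊r / (2 : ℚ) ^ φ.shift ⌊r⌋.toNat⌋).toNat with ht
  apply min_eq_left
  have hc : (0 : ℚ) < 2 ^ φ.shift ⌊r⌋.toNat := by positivity
  have h0 : 0 ≤ ⌊r / (2 : ℚ) ^ φ.shift ⌊r⌋.toNat⌋ := Int.floor_nonneg.mpr (div_nonneg hr hc.le)
  have hcast : (t : ℚ) = (⌊r / (2 : ℚ) ^ φ.shift ⌊r⌋.toNat⌋ : ℚ) := by
    rw [ht]; exact_mod_cast Int.toNat_of_nonneg h0
  have h1 : (t : ℚ) ≤ r / 2 ^ φ.shift ⌊r⌋.toNat := by rw [hcast]; exact Int.floor_le _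
  have h2 : (t : ℚ) * 2 ^ φ.shift ⌊r⌋.toNat ≤ φ.maxScaled :=
    calc (t : ℚ) * 2 ^ φ.shift ⌊r⌋.toNat
        ≤ r / 2 ^ φ.shift ⌊r⌋.toNat * 2 ^ φ.shift ⌊r⌋.toNat := mul_le_mul_of_nonneg_right h1 hc.le
      _ = r := div_mul_cancel₀ _ (ne_of_gt hc)
      _ ≤ φ.maxScaled := hle
  exact_mod_cast h2

/-- ROUND-DOWN ENVELOPE on the grid: `r - rdGrid r < 2^s` for `0 ≤ r ≤ maxScaled`. [folklore] -/
theorem sub_rdGrid_lt {r : ℚ} (hr : 0 ≤ r) (hle : r ≤ φ.maxScaled) :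
    r - φ.rdGrid r < 2 ^ φ.shift ⌊r⌋.toNat := by
  have hc : (0 : ℚ) < 2 ^ φ.shift ⌊r⌋.toNat := by positivity
  rw [rdGrid_eq_floor_mul hr hle]
  have h0 : 0 ≤ ⌊r / (2 : ℚ) ^ φ.shift ⌊r⌋.toNat⌋ := Int.floor_nonneg.mpr (div_nonneg hr hc.le)
  have hcast : ((⌊r / (2 : ℚ) ^ φ.shift ⌊r⌋.toNat⌋.toNat : ℕ) : ℚ)
      = (⌊r / (2 : ℚ) ^ φ.shift ⌊r⌋.toNat⌋ : ℚ) := by exact_mod_cast Int.toNat_of_nonneg h0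
  have h1 := Int.lt_floor_add_one (r / (2 : ℚ) ^ φ.shift ⌊r⌋.toNat)
  rw [div_lt_iff₀ hc] at h1
  push_cast
  rw [hcast]
  linarith

/-- ROUND-UP ENVELOPE on the grid: `ruGrid r - r < 2^s` for `0 ≤ r ≤ maxScaled`. [folklore] -/
theorem ruGrid_sub_lt {r : ℚ} (hr : 0 ≤ r) (hle : r ≤ φ.maxScaled) :
    (φ.ruGrid r : ℚ) - r < 2 ^ φ.shift ⌊r⌋.toNat := by
  have hc : (0 : ℚ) < 2 ^ φ.shift ⌊r⌋.toNat := by positivity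
  unfold ruGrid; rw [if_pos hle]
  have h0 : 0 ≤ ⌈r / (2 : ℚ) ^ φ.shift ⌊r⌋.toNat⌉ := Int.ceil_nonneg (div_nonneg hr hc.le)
  have hcast : ((⌈r / (2 : ℚ) ^ φ.shift ⌊r⌋.toNat⌉.toNat : ℕ) : ℚ)
      = (⌈r / (2 : ℚ) ^ φ.shift ⌊r⌋.toNat⌉ : ℚ) := by exact_mod_cast Int.toNat_of_nonneg h0
  have h2 : ((⌈r / (2 : ℚ) ^ φ.shift ⌊r⌋.toNat⌉ : ℚ) - 1) * 2 ^ φ.shift ⌊r⌋.toNat < r := by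
    have := Int.ceil_lt_add_one (r / (2 : ℚ) ^ φ.shift ⌊r⌋.toNat)
    have : (⌈r / (2 : ℚ) ^ φ.shift ⌊r⌋.toNat⌉ : ℚ) - 1 < r / 2 ^ φ.shift ⌊r⌋.toNat := by linarith
    exact (lt_div_iff₀ hc).mp this
  push_cast
  rw [hcast]
  linarith

end Format

namespace MiniFloat

open Format

variable {φ : Format}

/-- E2 (round down): for `|x| ≤ maxRat`, `0 ≤ x - ↓x < 2^s · quantum` with `s` the spacing
exponent of the binade of `|x|`. [folklore] -/
theorem sub_roundDown_lt {x : ℚ} (h : |x| ≤ φ.maxRat) :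
    x - (roundDown φ x).toRat < 2 ^ φ.shift ⌊|x| / φ.quantum⌋.toNat * φ.quantum := by
  have hq := φ.quantum_pos
  have hr : 0 ≤ |x| / φ.quantum := div_nonneg (abs_nonneg x) hq.le
  have hle : |x| / φ.quantum ≤ φ.maxScaled := by rw [div_le_iff₀ hq]; exact h
  rw [toRat_roundDown]
  split
  · rename_i hx
    -- x < 0: ↓x = -(ruGrid r) q with r = -x/q; x - ↓x = ruGrid·q - (-x) = (ruGrid r - r) q
    have h1 := Format.ruGrid_sub_lt (φ := φ) hr hle
    rw [abs_of_neg hx] at h1 ⊢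
    have := mul_lt_mul_of_pos_right h1 hq
    rw [sub_mul, div_mul_cancel₀ _ (ne_of_gt hq)] at this
    linarith
  · rename_i hx
    have h1 := Format.sub_rdGrid_lt (φ := φ) hr hle
    rw [abs_of_nonneg (not_lt.mp hx)] at h1 ⊢
    have := mul_lt_mul_of_pos_right h1 hq
    rw [sub_mul, div_mul_cancel₀ _ (ne_of_gt hq)] at this
    linarith

/-- E2 (round up): for `|x| ≤ maxRat`, `0 ≤ ↑x - x < 2^s · quantum`. [folklore] -/
theorem roundUp_sub_lt {x : ℚ} (h : |x| ≤ φ.maxRat) :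
    (roundUp φ x).toRat - x < 2 ^ φ.shift ⌊|x| / φ.quantum⌋.toNat * φ.quantum := by
  by_cases hx : x = 0
  · subst hx
    rw [toRat_roundUp, if_neg (lt_irrefl 0), abs_zero, zero_div]
    have h0 : φ.ruGrid ((0 : ℕ) : ℚ) = 0 :=
      Format.ruGrid_eq_self_of_representable
        (representable_of_lt_pow (Nat.two_pow_pos _) (Nat.zero_le _))
    rw [Nat.cast_zero] at h0
    rw [h0]; simp [φ.quantum_pos]
  · rw [toRat_roundUp_eq_neg hx]
    have := sub_roundDown_lt (φ := φ) (x := -x) (by rwa [abs_neg])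
    rw [abs_neg] at this
    linarith

/-- E2 (toward zero): for `|x| ≤ maxRat`, `|x - RZ x| < 2^s · quantum`. [folklore] -/
theorem abs_sub_roundTowardZero_lt {x : ℚ} (h : |x| ≤ φ.maxRat) :
    |x - (roundTowardZero φ x).toRat| < 2 ^ φ.shift ⌊|x| / φ.quantum⌋.toNat * φ.quantum := by
  have hq := φ.quantum_pos
  have hr : 0 ≤ |x| / φ.quantum := div_nonneg (abs_nonneg x) hq.le
  have hle : |x| / φ.quantum ≤ φ.maxScaled := by rw [div_le_iff₀ hq]; exact h
  have h1 := Format.sub_rdGrid_lt (φ := φ) hr hle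
  have h2 := Format.rdGrid_le (φ := φ) hr
  have e : |x - (roundTowardZero φ x).toRat|
      = (|x| / φ.quantum - φ.rdGrid (|x| / φ.quantum)) * φ.quantum := by
    rw [toRat_roundTowardZero]
    by_cases hx : x < 0
    · rw [if_pos hx, abs_of_neg hx]
      rw [abs_of_nonpos]
      · field_simp; ring
      · -- x - (-(rd)·q) = x + rd q ≤ 0 since rd q ≤ |x| = -x
        have : (φ.rdGrid (-x / φ.quantum) : ℚ) * φ.quantum ≤ -x := by
          have := Format.rdGrid_le (φ := φ) (r := -x / φ.quantum)
            (div_nonneg (by linarith) hq.le)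
          rwa [le_div_iff₀ hq] at this
        rw [abs_of_neg hx] at *
        linarith
    · rw [if_neg hx, abs_of_nonneg (not_lt.mp hx)]
      rw [abs_of_nonneg]
      · field_simp
      · have : (φ.rdGrid (x / φ.quantum) : ℚ) * φ.quantum ≤ x := by
          have := Format.rdGrid_le (φ := φ) (r := x / φ.quantum)
            (div_nonneg (not_lt.mp hx) hq.le)
          rwa [le_div_iff₀ hq] at this
        rw [abs_of_nonneg (not_lt.mp hx)] at *
        linarith
  rw [e]
  exact mul_lt_mul_of_pos_right h1 hq

/-- E2 (toward zero, relative): in the normal range `2^m·quantum ≤ |x| ≤ maxRat`,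
`|x - RZ x| < 2u · |x|`. [folklore] -/
theorem abs_sub_roundTowardZero_lt_two_mul {x : ℚ} (hlo : 2 ^ φ.manBits * φ.quantum ≤ |x|)
    (hhi : |x| ≤ φ.maxRat) :
    |x - (roundTowardZero φ x).toRat| < 2 * φ.unitRoundoff * |x| := by
  have hq := φ.quantum_pos
  have hr : 0 ≤ |x| / φ.quantum := div_nonneg (abs_nonneg x) hq.le
  have hrm : (2 : ℚ) ^ φ.manBits ≤ |x| / φ.quantum := by rw [le_div_iff₀ hq]; exact hlo
  have h1 := abs_sub_roundTowardZero_lt hhi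
  -- 2^s q ≤ 2u |x| since 2^(m+s) ≤ |x|/q (or s = 0 and 2^m ≤ |x|/q)
  have hfloor : (2 : ℚ) ^ (φ.manBits + φ.shift ⌊|x| / φ.quantum⌋.toNat) ≤ |x| / φ.quantum := by
    rcases Format.shift_floor_dichotomy (φ := φ) hr with hs | hfl
    · rw [hs, add_zero]; exact hrm
    · exact hfl
  refine lt_of_lt_of_le h1 ?_
  have hx' : (2 : ℚ) ^ (φ.manBits + φ.shift ⌊|x| / φ.quantum⌋.toNat) * φ.quantum ≤ |x| := by
    rwa [le_div_iff₀ hq] at hfloor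
  have hm : (0 : ℚ) < 2 ^ φ.manBits := by positivity
  calc (2 : ℚ) ^ φ.shift ⌊|x| / φ.quantum⌋.toNat * φ.quantum
      = (2 ^ (φ.manBits + φ.shift ⌊|x| / φ.quantum⌋.toNat) * φ.quantum) / 2 ^ φ.manBits := by
        rw [pow_add]; field_simp
    _ ≤ |x| / 2 ^ φ.manBits := div_le_div_of_nonneg_right hx' hm.le
    _ = 2 * φ.unitRoundoff * |x| := by rw [Format.unitRoundoff_eq, pow_succ]; field_simp

end MiniFloat

end Literature.ComputerArithmetic.FloatingPoint
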